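import Literature.Analysis.FluidPDE.HardSphereTrajectoryMeasurable
import Literature.MathematicalPhysics.KineticTheory.HardSphereBBGKYLiouvilleFlow
import Summits.AtomisticToContinuum.HydrodynamicLimit.Theorems.OneFlightGossipEngineCollisionActivityTailsCutoff
import Summits.AtomisticToContinuum.HydrodynamicLimit.Theorems.OneFlightGossipEngineCollisionActivityTailsPairVirial
import Summits.AtomisticToContinuum.HydrodynamicLimit.Theorems.OneFlightGossipEngineCollisionActivityTailsCollisionStep
import HarnessLib

/-!
# `stub_activityDomination`: the co-moving pair-virial domination of the window activity (line SketchK1)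

Crux `Summit.AtomisticToContinuum.HydrodynamicLimit.Theses.OneFlightGossipEngine.CollisionActivityTails`
(stmt-AtomisticToContinuum-13734), line `SketchK1`, registered stub `stub_activityDomination : ActivityDomination` —
the deterministic LEVER of the line: for every hard-sphere flow on `𝕋³` at reduced diameter `0 < σ ≤ 1/8`, every
window `(s, s + w]`, `w = τ (N+1)^{-1/3}`, every good datum and every tagged sphere `i`,

`a_i ≤ F¹_i + C (F²_i + Fcr_i)` (`act ≤ endpointTerm + C (nearFieldKinetic + crowdedActivity)`),

with an absolute constant `C`. Assembly of the three helper toolkits `CutoffFieldToolkit` (the radial cutoff `ζ_ε`: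
identity on the core, zero beyond `2ε`, `‖ζ‖ ≤ 2ε`, `⟪Dζ h, h⟫ ≥ −2D‖h‖²`, contact-segment bound), `PairVirialToolkit`
(`G_i = pairVirial ζ i`: free-flight derivative `pairVirialDeriv ζ i`, `|G_i| ≤ 2ε P_i`, `Ġ_i ≥ −2D Σ_{near}|v_j − v_i|²`)
and `CollisionStepToolkit` (at each collision `2ε · ownImpulse ≤ jump(G_i) + ε · max 125 D · crowdImpulse`).
The weak balance law of the tree (`IsHardSphereTrajectory.sub_eq_integral_add_collisionalTransfer`) telescopes the
jumps over the window: `Σ jumps = G_i(s+w) − G_i(s) − ∫ Ġ_i`; the crux's activity is `(σ/τ) Σ_t ownImpulse`, the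
crowded activity is `(σ/τ) Σ_t crowdImpulse` (`collisionSum_eq_finset_sum`, pre-collisional velocities = left
limits), and `ε/w = σ/τ` converts `2ε Σ own ≤ 2ε(P_s + P_{s+w}) + 2D ∫ relKin + ε C₁ Σ crowd` into the domination
with `C = max (max D (max 125 D / 2)) 1`. For `N = 0` (one sphere) there are no collisions and `a_i = 0`.
-/

noncomputable section

open Set Filter Topology Function MeasureTheory
open scoped InnerProductSpace

/-! ## The assembly -/

namespace Summit.AtomisticToContinuum.HydrodynamicLimit.Theorems.CollisionActivityTailsActivityDomination

open Literature.Analysis.FluidPDE Literature.Analysis.FunctionSpaces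
open Literature.MathematicalPhysics.KineticTheory
open Summit.AtomisticToContinuum.HydrodynamicLimit.Theorems.CollisionActivityTailsPairVirial (pairVirialDeriv
  PairVirialToolkit stub_pairVirialToolkit)
open Summit.AtomisticToContinuum.HydrodynamicLimit.Theorems.CollisionActivityTailsContact (impulse ownImpulse crowdImpulse)
open Summit.AtomisticToContinuum.HydrodynamicLimit.Theorems.CollisionActivityTailsCollisionStep (CollisionStepToolkit
  stub_collisionStepToolkit)
open Summit.AtomisticToContinuum.HydrodynamicLimit.Theorems.CollisionActivityTailsCutoff (cutoffField CutoffFieldToolkit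
  stub_cutoffFieldToolkit)

/-! ### Vocabulary of the skeleton (verbatim) -/

/-- A hard-sphere flow of `N + 1` spheres of reduced diameter `σ` on `𝕋³` (the crux's `Φ N`). -/
abbrev Flow (σ : ℝ) (N : ℕ) : Type :=
  HardSphereFlow (Torus.geometry (Fin 3)) (hsDiameter σ N) (N + 1)

/-- Phase space of `N + 1` spheres on `𝕋³`. -/
abbrev Cfg (N : ℕ) : Type := Config (N + 1) (Fin 3) T3

/-- The crux's window `w_N = τ (N+1)^{-1/3}`. -/
def window (τ : ℝ) (N : ℕ) : ℝ := τ * ((N : ℝ) + 1) ^ (-(1 / 3 : ℝ))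

/-- The crux's window ACTIVITY of particle `i` over `(s, s + w]` along the orbit of `z` (verbatim the crux's `act`). -/
def act {σ : ℝ} {N : ℕ} (Φ : Flow σ N) (τ s : ℝ) (i : Fin (N + 1)) (z : Cfg N) : ℝ :=
  σ / τ * Φ.collisionSum (Set.Ioc s (s + window τ N))
    (fun c => if c.fst = i then ‖c.postVel.1 - c.preVel.1‖ else 0) z

/-- Minimal-image distance of two points of `𝕋³`. -/
def tdist (x y : T3) : ℝ := ‖(Torus.geometry (Fin 3)).sepVec x y‖

/-- Number of centres within distance `r` of the centre of particle `i` (itself included). -/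
def nearCount {N : ℕ} (z : Cfg N) (i : Fin (N + 1)) (r : ℝ) : ℕ :=
  (Finset.univ.filter fun j : Fin (N + 1) => tdist (z j).1 (z i).1 ≤ r).card

/-- Near-field relative momentum at `i`. -/
def relMomentumNear {N : ℕ} (z : Cfg N) (i : Fin (N + 1)) (r : ℝ) : ℝ :=
  ∑ j : Fin (N + 1), if j ≠ i ∧ tdist (z j).1 (z i).1 ≤ r then ‖(z j).2 - (z i).2‖ else 0

/-- Near-field relative kinetic energy at `i`. -/
def relKineticNear {N : ℕ} (z : Cfg N) (i : Fin (N + 1)) (r : ℝ) : ℝ :=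
  ∑ j : Fin (N + 1), if j ≠ i ∧ tdist (z j).1 (z i).1 ≤ r then ‖(z j).2 - (z i).2‖ ^ 2 else 0

/-- `F¹_i`: the endpoint term. -/
def endpointTerm {σ : ℝ} {N : ℕ} (Φ : Flow σ N) (τ s : ℝ) (i : Fin (N + 1)) (z : Cfg N) : ℝ :=
  σ / τ * (relMomentumNear (Φ.flow s z) i (2 * hsDiameter σ N) +
    relMomentumNear (Φ.flow (s + window τ N) z) i (2 * hsDiameter σ N))

/-- `F²_i`: the near-field kinetic term. -/
def nearFieldKinetic {σ : ℝ} {N : ℕ} (Φ : Flow σ N) (τ s : ℝ) (i : Fin (N + 1)) (z : Cfg N) : ℝ :=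
  (window τ N)⁻¹ * ∫ t in s..(s + window τ N), relKineticNear (Φ.flow t z) i (2 * hsDiameter σ N)

/-- `Fcr_i`: the crowded collisional activity. -/
def crowdedActivity {σ : ℝ} {N : ℕ} (Φ : Flow σ N) (τ s : ℝ) (i : Fin (N + 1)) (z : Cfg N) : ℝ :=
  σ / τ * Φ.collisionPairSum (Set.Ioc s (s + window τ N))
    (fun t y k l =>
      if tdist (y k).1 (y i).1 ≤ 3 * hsDiameter σ N ∧ tdist (y l).1 (y i).1 ≤ 3 * hsDiameter σ N ∧
          3 ≤ nearCount y i (3 * hsDiameter σ N) then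
        ‖(HardSphereCollisionRecord.ofConfig (Torus.geometry (Fin 3)) (hsDiameter σ N) y t k l).postVel.1 -
          (HardSphereCollisionRecord.ofConfig (Torus.geometry (Fin 3)) (hsDiameter σ N) y t k l).preVel.1‖
      else 0) z

/-- **ACTIVITY DOMINATION** (the registered stub's statement, verbatim from the skeleton). -/
def ActivityDomination : Prop :=
  ∃ C : ℝ, 0 < C ∧ ∀ (σ : ℝ), 0 < σ → σ ≤ 1 / 8 → ∀ (N : ℕ) (Φ : Flow σ N) (τ : ℝ), 0 < τ →
    ∀ (s : ℝ), ∀ z ∈ Φ.good, ∀ i : Fin (N + 1),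
      act Φ τ s i z ≤ endpointTerm Φ τ s i z + C * (nearFieldKinetic Φ τ s i z + crowdedActivity Φ τ s i z)

/-- The cutoff toolkit in ABSTRACT form (an `∃ ζ` statement; supplied by `CutoffFieldToolkit` with
`ζ = cutoffField ε`). -/
def AbstractCutoffToolkit : Prop :=
  ∃ D : ℝ, 0 ≤ D ∧ ∀ ε : ℝ, 0 < ε → ∃ ζ : V3 → V3,
    ContDiff ℝ 1 ζ ∧ (∀ y : V3, ‖y‖ ≤ ε → ζ y = y) ∧ (∀ y : V3, 2 * ε ≤ ‖y‖ → ζ y = 0) ∧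
    (∀ y : V3, ‖ζ y‖ ≤ ‖y‖ ∧ ‖ζ y‖ ≤ 2 * ε) ∧
    (∀ y h : V3, -(2 * D) * ‖h‖ ^ 2 ≤ ⟪fderiv ℝ ζ y h, h⟫_ℝ) ∧
    (∀ (a m : V3), ‖m‖ = 1 → ∀ t : ℝ, 0 ≤ t → -(2 * D) * t ≤ ⟪ζ (a + t • m) - ζ a, m⟫_ℝ)

/-! ### Scaling and the one-sphere case -/
/-- `ε / w = σ / τ`: `ε = σ ℓ`, `w = τ ℓ`, `ℓ = (N+1)^{-1/3}`. -/
theorem hsDiameter_div_window {σ τ : ℝ} (hτ : 0 < τ) (N : ℕ) :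
    hsDiameter σ N / window τ N = σ / τ := by
  unfold hsDiameter window
  have hℓ : (0 : ℝ) < ((N : ℝ) + 1) ^ (-(1 / 3 : ℝ)) := Real.rpow_pos_of_pos (by positivity) _
  push_cast
  field_simp

/-- The window is positive. -/
theorem window_pos {τ : ℝ} (hτ : 0 < τ) (N : ℕ) : 0 < window τ N :=
  mul_pos hτ (Real.rpow_pos_of_pos (by positivity) _)

/-- For `N ≥ 1` the diameter is strictly smaller than the reduced diameter: `ε = σ (N+1)^{-1/3} < σ`. -/
theorem hsDiameter_lt {σ : ℝ} (hσ : 0 < σ) {N : ℕ} (hN : 1 ≤ N) : hsDiameter σ N < σ := by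
  unfold hsDiameter
  have h1 : (1 : ℝ) < ((N + 1 : ℕ) : ℝ) := by exact_mod_cast Nat.lt_succ_of_le hN
  have h2 : ((N + 1 : ℕ) : ℝ) ^ (-(1 / 3 : ℝ)) < 1 :=
    Real.rpow_lt_one_of_one_lt_of_neg h1 (by norm_num)
  calc σ * ((N + 1 : ℕ) : ℝ) ^ (-(1 / 3 : ℝ)) < σ * 1 := mul_lt_mul_of_pos_left h2 hσ
    _ = σ := mul_one σ

/-- With one sphere there are no contact pairs. -/
theorem contactPairs_eq_empty_of_subsingleton {ε : ℝ} (y : Cfg 0) :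
    contactPairs (Torus.geometry (Fin 3)) ε y = ∅ := by
  rw [Finset.eq_empty_iff_forall_notMem]
  rintro ⟨p, q⟩ hp
  exact (mem_contactPairs.1 hp).1 (Fin.ext (by have := p.isLt; have := q.isLt; omega))

/-! ### Nonnegativity of the functionals -/
/-- The near-field relative kinetic energy is nonnegative. -/
theorem relKineticNear_nonneg {N : ℕ} (z : Cfg N) (i : Fin (N + 1)) (r : ℝ) : 0 ≤ relKineticNear z i r := by
  unfold relKineticNear
  exact Finset.sum_nonneg fun j _ => by split_ifs <;> positivity

/-- `F²` is nonnegative. -/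
theorem nearFieldKinetic_nonneg {σ : ℝ} {N : ℕ} (Φ : Flow σ N) {τ : ℝ} (hτ : 0 < τ) (s : ℝ) (i : Fin (N + 1))
    (z : Cfg N) : 0 ≤ nearFieldKinetic Φ τ s i z := by
  unfold nearFieldKinetic
  refine mul_nonneg (inv_nonneg.2 (window_pos hτ N).le) ?_
  exact intervalIntegral.integral_nonneg (by linarith [window_pos hτ N]) fun t _ => relKineticNear_nonneg _ _ _

/-- A collision pair sum of a nonnegative summand along the flow is nonnegative. -/
theorem collisionPairSum_nonneg {σ : ℝ} {N : ℕ} (Φ : Flow σ N) (S : Set ℝ)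
    {g : ℝ → Cfg N → Fin (N + 1) → Fin (N + 1) → ℝ} (hg : ∀ t y k l, 0 ≤ g t y k l) (z : Cfg N) :
    0 ≤ Φ.collisionPairSum S g z := by
  unfold HardSphereFlow.collisionPairSum Literature.Analysis.FluidPDE.collisionPairSum
  exact finsum_nonneg fun t => finsum_nonneg fun _ => Finset.sum_nonneg fun p _ => hg _ _ _ _

/-- `Fcr` is nonnegative. -/
theorem crowdedActivity_nonneg {σ : ℝ} {N : ℕ} (hσ : 0 ≤ σ) (Φ : Flow σ N) {τ : ℝ} (hτ : 0 ≤ τ) (s : ℝ)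
    (i : Fin (N + 1)) (z : Cfg N) : 0 ≤ crowdedActivity Φ τ s i z := by
  unfold crowdedActivity
  refine mul_nonneg (div_nonneg hσ hτ) (collisionPairSum_nonneg Φ _ (fun t y k l => ?_) z)
  split_ifs <;> positivity

/-! ### Measurability and boundedness of the near-field kinetic energy along an orbit -/
/-- The near-ball event is measurable. -/
theorem measurableSet_near {N : ℕ} (j i : Fin (N + 1)) (r : ℝ) :
    MeasurableSet {z : Cfg N | j ≠ i ∧ tdist (z j).1 (z i).1 ≤ r} := by
  by_cases hji : j = i
  · simp [hji]
  · simp only [ne_eq, hji, not_false_eq_true, true_and]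
    have hm : Measurable fun z : Cfg N => tdist (z j).1 (z i).1 := by
      unfold tdist
      exact (Torus.measurable_geometry_sepVec.comp
        ((measurable_pi_apply j).fst.prodMk (measurable_pi_apply i).fst)).norm
    exact measurableSet_le hm measurable_const

/-- The near-field relative kinetic energy is a measurable function of the configuration. -/
theorem measurable_relKineticNear {N : ℕ} (i : Fin (N + 1)) (r : ℝ) :
    Measurable fun z : Cfg N => relKineticNear z i r := by
  unfold relKineticNear
  refine Finset.measurable_sum _ fun j _ => Measurable.ite (measurableSet_near j i r) ?_ measurable_const
  exact (((measurable_pi_apply j).snd.sub (measurable_pi_apply i).snd).norm).pow_const 2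

/-- Crude energy bound: `relKineticNear y i r ≤ (4 + 4(N+1)) E(y)`. -/
theorem relKineticNear_le_energy {N : ℕ} (y : Cfg N) (i : Fin (N + 1)) (r : ℝ) :
    relKineticNear y i r ≤ (4 + 4 * ((N : ℝ) + 1)) * configEnergy y := by
  have hE : configEnergy y = 2⁻¹ * ∑ j, ‖(y j).2‖ ^ 2 := rfl
  have hvi : ‖(y i).2‖ ^ 2 ≤ ∑ j, ‖(y j).2‖ ^ 2 :=
    Finset.single_le_sum (fun j _ => sq_nonneg ‖(y j).2‖) (Finset.mem_univ i)
  have hterm : ∀ j, (if j ≠ i ∧ tdist (y j).1 (y i).1 ≤ r then ‖(y j).2 - (y i).2‖ ^ 2 else 0) ≤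
      2 * ‖(y j).2‖ ^ 2 + 2 * ‖(y i).2‖ ^ 2 := fun j => by
    split_ifs
    · have h := norm_sub_le (y j).2 (y i).2
      have h' : ‖(y j).2 - (y i).2‖ ^ 2 ≤ (‖(y j).2‖ + ‖(y i).2‖) ^ 2 := pow_le_pow_left₀ (norm_nonneg _) h 2
      nlinarith [h', sq_nonneg (‖(y j).2‖ - ‖(y i).2‖)]
    · positivity
  calc relKineticNear y i r ≤ ∑ j, (2 * ‖(y j).2‖ ^ 2 + 2 * ‖(y i).2‖ ^ 2) := Finset.sum_le_sum fun j _ => hterm j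
    _ = 2 * ∑ j, ‖(y j).2‖ ^ 2 + 2 * ((N : ℝ) + 1) * ‖(y i).2‖ ^ 2 := by
        rw [Finset.sum_add_distrib, ← Finset.mul_sum, Finset.sum_const, Finset.card_univ, Fintype.card_fin,
          nsmul_eq_mul]
        push_cast
        ring
    _ ≤ (4 + 4 * ((N : ℝ) + 1)) * configEnergy y := by
        rw [hE]
        nlinarith [hvi, Finset.sum_nonneg fun j (_ : j ∈ Finset.univ) => sq_nonneg ‖(y j).2‖,
          (by positivity : (0 : ℝ) ≤ (N : ℝ) + 1)]

/-- Along a good orbit the near-field kinetic energy is interval integrable on every window (measurable in time,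
bounded by the conserved energy). -/
theorem intervalIntegrable_relKineticNear {σ : ℝ} {N : ℕ} (Φ : Flow σ N) {z : Cfg N} (hz : z ∈ Φ.good)
    (i : Fin (N + 1)) (r a b : ℝ) (hab : a ≤ b) :
    IntervalIntegrable (fun t => relKineticNear (Φ.flow t z) i r) volume a b := by
  have hγ := Φ.isTrajectory z hz
  have hmeas : Measurable fun t => relKineticNear (Φ.flow t z) i r :=
    (measurable_relKineticNear i r).comp hγ.measurable_torus
  rw [intervalIntegrable_iff_integrableOn_Ioc_of_le hab]
  refine ⟨hmeas.aestronglyMeasurable, HasFiniteIntegral.of_bounded (C := (4 + 4 * ((N : ℝ) + 1)) * configEnergy z)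
    (ae_of_all _ fun t => ?_)⟩
  rw [Real.norm_eq_abs, abs_of_nonneg (relKineticNear_nonneg _ _ _), ← Φ.configEnergy_flow hz t]
  exact relKineticNear_le_energy _ _ _

/-! ### Identification of the crux's collision sums with the per-collision impulses -/
section Identification

variable {σ : ℝ} {N : ℕ}

/-- The activity as `(σ/τ) Σ_{collision times in the window} ownImpulse`. -/
theorem act_eq_sum (Φ : Flow σ N) {z : Cfg N} (hz : z ∈ Φ.good) (τ s : ℝ) (i : Fin (N + 1))
    (hfin : (collisionTimes (Torus.geometry (Fin 3)) (hsDiameter σ N) (fun t => Φ.flow t z) ∩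
      Set.Ioc s (s + window τ N)).Finite) :
    act Φ τ s i z = σ / τ * ∑ t ∈ hfin.toFinset, ownImpulse (hsDiameter σ N) (fun t => Φ.flow t z) i t := by
  have hγ := Φ.isTrajectory z hz
  unfold act HardSphereFlow.collisionSum
  rw [collisionSum_eq_finset_sum hfin]
  congr 1
  refine Finset.sum_congr rfl fun t _ => Finset.sum_congr rfl fun p hp => ?_
  rw [hγ.ofConfig_preVel_eq_leftLim hp]
  simp only [HardSphereCollisionRecord.ofConfig_fst, HardSphereCollisionRecord.ofConfig_postVel]
  rfl

/-- The crowded activity as `(σ/τ) Σ_{collision times in the window} crowdImpulse`. -/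
theorem crowdedActivity_eq_sum (Φ : Flow σ N) {z : Cfg N} (hz : z ∈ Φ.good) (τ s : ℝ) (i : Fin (N + 1))
    (hfin : (collisionTimes (Torus.geometry (Fin 3)) (hsDiameter σ N) (fun t => Φ.flow t z) ∩
      Set.Ioc s (s + window τ N)).Finite) :
    crowdedActivity Φ τ s i z =
      σ / τ * ∑ t ∈ hfin.toFinset, crowdImpulse (hsDiameter σ N) (fun t => Φ.flow t z) i t := by
  have hγ := Φ.isTrajectory z hz
  unfold crowdedActivity HardSphereFlow.collisionPairSum
  rw [collisionPairSum_eq_finset_sum hfin]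
  congr 1
  refine Finset.sum_congr rfl fun t _ => Finset.sum_congr rfl fun p hp => ?_
  dsimp only
  rw [hγ.ofConfig_preVel_eq_leftLim hp]
  simp only [HardSphereCollisionRecord.ofConfig_postVel]
  rfl

end Identification

/-! ### The domination -/
/-- **Assembly**: the three toolkits imply `ActivityDomination`. -/
theorem activityDomination_of (hC : AbstractCutoffToolkit) (hP : PairVirialToolkit) (hS : CollisionStepToolkit) :
    ActivityDomination := by
  obtain ⟨D, hD0, hC⟩ := hC
  set C₁ : ℝ := max 125 D with hC₁
  have hC₁0 : 0 ≤ C₁ := le_max_of_le_left (by norm_num)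
  refine ⟨max (max D (C₁ / 2)) 1, lt_max_of_lt_right one_pos, ?_⟩
  intro σ hσ hσ8 N Φ τ hτ s z hz i
  set ε := hsDiameter σ N with hεdef
  set w := window τ N with hwdef
  have hε : 0 < ε := hsDiameter_pos hσ N
  have hw : 0 < w := window_pos hτ N
  have hεw : ε / w = σ / τ := hsDiameter_div_window hτ N
  have hF2 := nearFieldKinetic_nonneg Φ hτ s i z
  have hFcr := crowdedActivity_nonneg hσ.le Φ hτ.le s i z
  have hF1 : 0 ≤ endpointTerm Φ τ s i z := by
    unfold endpointTerm relMomentumNear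
    refine mul_nonneg (div_nonneg hσ.le hτ.le) (add_nonneg ?_ ?_) <;>
      exact Finset.sum_nonneg fun j _ => by split_ifs <;> positivity
  have hCD : D ≤ max (max D (C₁ / 2)) 1 := (le_max_left _ _).trans (le_max_left _ _)
  have hCC : C₁ / 2 ≤ max (max D (C₁ / 2)) 1 := (le_max_right _ _).trans (le_max_left _ _)
  -- the orbit and the finite set of collision times in the window
  have hγ := Φ.isTrajectory z hz
  have hfin := hγ.finite_collisionTimes_inter_Ioc s (s + w)
  -- one sphere: no collisions
  rcases Nat.eq_zero_or_pos N with hN0 | hNpos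
  · subst hN0
    have hact : act Φ τ s i z = 0 := by
      rw [act_eq_sum Φ hz τ s i hfin]
      simp [ownImpulse, contactPairs_eq_empty_of_subsingleton]
    rw [hact]
    exact add_nonneg hF1 (mul_nonneg (le_trans zero_le_one (le_max_right _ _)) (add_nonneg hF2 hFcr))
  -- `N ≥ 1`: `2ε < 1/4`
  have hε8 : ε ≤ 1 / 8 := (hsDiameter_le hσ.le N).trans hσ8
  have h2ε : 2 * ε < 1 / 4 := by
    have := hsDiameter_lt hσ hNpos
    rw [← hεdef] at this
    linarith
  -- the cutoff field and the pair-virial toolkit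
  obtain ⟨ζ, hζ1, hcore, hvan, hnb, hform, hseg⟩ := hC ε hε
  obtain ⟨hderiv, hcont, habs, hstream⟩ := hP ζ ε hε.le h2ε hζ1 hvan (N + 1) i
  have habs' := habs fun y => (hnb y).2
  have hstream' := hstream D hD0 hform
  -- the weak balance law on `[s, s + w]`
  have hGt : ∀ x : T3, Continuous ((Torus.geometry (Fin 3)).translate x) := fun x =>
    (continuous_const.add Torus.continuous_proj : Continuous fun v : V3 => x + Torus.proj v)
  obtain ⟨hint, hbal⟩ := hγ.sub_eq_integral_add_collisionalTransfer hGt hderiv hcont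
    (le_add_of_nonneg_right hw.le : s ≤ s + w)
  rw [collisionalTransfer_eq_sum _ hfin] at hbal
  -- the per-collision steps, summed
  have hstep : ∀ t ∈ hfin.toFinset,
      2 * ε * ownImpulse ε (fun t => Φ.flow t z) i t ≤
        collisionJump (CollisionActivityTailsContact.pairVirial ζ i) (fun t => Φ.flow t z) t +
          ε * C₁ * crowdImpulse ε (fun t => Φ.flow t z) i t := fun t ht =>
    hS (N + 1) ε D hε hε8 hD0 _ hγ ζ hcore hvan (fun y => (hnb y).2) hseg i t ((Set.Finite.mem_toFinset _).1 ht).1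
  have hsum := Finset.sum_le_sum hstep
  rw [← Finset.mul_sum, Finset.sum_add_distrib, ← Finset.mul_sum] at hsum
  -- the jumps of the two (identical) pair virials agree
  have hpv : (CollisionActivityTailsContact.pairVirial ζ i : Cfg N → ℝ) =
      CollisionActivityTailsPairVirial.pairVirial ζ i := rfl
  rw [hpv] at hsum
  -- endpoint and streaming bounds
  have hends : ∀ t, |CollisionActivityTailsPairVirial.pairVirial ζ i (Φ.flow t z)| ≤
      2 * ε * relMomentumNear (Φ.flow t z) i (2 * ε) := fun t => habs' _
  have hstr : -(∫ t in s..(s + w), pairVirialDeriv ζ i (Φ.flow t z)) ≤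
      2 * D * ∫ t in s..(s + w), relKineticNear (Φ.flow t z) i (2 * ε) := by
    rw [← intervalIntegral.integral_const_mul, ← intervalIntegral.integral_neg]
    refine intervalIntegral.integral_mono_on (le_add_of_nonneg_right hw.le) hint.neg
      ((intervalIntegrable_relKineticNear Φ hz i (2 * ε) s (s + w) (le_add_of_nonneg_right hw.le)).const_mul _)
      fun t _ => ?_
    have := hstream' (Φ.flow t z)
    change -(2 * D) * relKineticNear (Φ.flow t z) i (2 * ε) ≤ _ at this
    linarith
  -- identification of the crux's sums
  have hact := act_eq_sum Φ hz τ s i hfin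
  have hcr := crowdedActivity_eq_sum Φ hz τ s i hfin
  -- bookkeeping: abbreviate the sums and integrals
  set SO := ∑ t ∈ hfin.toFinset, ownImpulse ε (fun t => Φ.flow t z) i t with hSO
  set SC := ∑ t ∈ hfin.toFinset, crowdImpulse ε (fun t => Φ.flow t z) i t with hSC
  set SJ := ∑ t ∈ hfin.toFinset, collisionJump (CollisionActivityTailsPairVirial.pairVirial ζ i)
    (fun t => Φ.flow t z) t with hSJ
  set IK := ∫ t in s..(s + w), relKineticNear (Φ.flow t z) i (2 * ε) with hIK
  set Ps := relMomentumNear (Φ.flow s z) i (2 * ε) with hPs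
  set Pw := relMomentumNear (Φ.flow (s + w) z) i (2 * ε) with hPw
  have hSC0 : 0 ≤ SC := Finset.sum_nonneg fun t _ =>
    Finset.sum_nonneg fun p _ => by split_ifs <;> [exact norm_nonneg _; exact le_rfl]
  have hIK0 : 0 ≤ IK := intervalIntegral.integral_nonneg (by linarith) fun t _ => relKineticNear_nonneg _ _ _
  -- `SJ = G(s+w) − G(s) − ∫ Ġ ≤ 2ε (Ps + Pw) + 2D IK`
  have hSJ_le : SJ ≤ 2 * ε * (Ps + Pw) + 2 * D * IK := by
    have e : SJ = CollisionActivityTailsPairVirial.pairVirial ζ i (Φ.flow (s + w) z) -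
        CollisionActivityTailsPairVirial.pairVirial ζ i (Φ.flow s z) -
        ∫ t in s..(s + w), pairVirialDeriv ζ i (Φ.flow t z) := by rw [hSJ]; linarith
    have h1 := hends (s + w)
    have h2 := hends s
    rw [abs_le] at h1 h2
    linarith [h1.2, h2.1, hstr]
  have hmain : 2 * ε * SO ≤ 2 * ε * (Ps + Pw) + 2 * D * IK + ε * C₁ * SC := by linarith
  have hcr' : crowdedActivity Φ τ s i z = σ / τ * SC := hcr
  have hF1' : endpointTerm Φ τ s i z = σ / τ * (Ps + Pw) := rfl
  have hF2' : nearFieldKinetic Φ τ s i z = w⁻¹ * IK := rfl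
  rw [hact, hF1', hF2', hcr', ← hεw]
  have hw' : 0 < w⁻¹ := inv_pos.2 hw
  have key : ε / w * SO ≤ ε / w * (Ps + Pw) + D * (w⁻¹ * IK) + C₁ / 2 * (ε / w * SC) := by
    have := mul_le_mul_of_nonneg_left hmain (le_of_lt (half_pos hw'))
    have e1 : w⁻¹ / 2 * (2 * ε * SO) = ε / w * SO := by ring
    have e2 : w⁻¹ / 2 * (2 * ε * (Ps + Pw) + 2 * D * IK + ε * C₁ * SC) =
        ε / w * (Ps + Pw) + D * (w⁻¹ * IK) + C₁ / 2 * (ε / w * SC) := by ring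
    rw [e1, e2] at this
    exact this
  have hIK' : 0 ≤ w⁻¹ * IK := mul_nonneg hw'.le hIK0
  have hSC' : 0 ≤ ε / w * SC := mul_nonneg (div_nonneg hε.le hw.le) hSC0
  calc ε / w * SO ≤ ε / w * (Ps + Pw) + D * (w⁻¹ * IK) + C₁ / 2 * (ε / w * SC) := key
    _ ≤ ε / w * (Ps + Pw) + max (max D (C₁ / 2)) 1 * (w⁻¹ * IK + ε / w * SC) := by
        rw [mul_add]
        have h1 := mul_le_mul_of_nonneg_right hCD hIK'
        have h2 := mul_le_mul_of_nonneg_right hCC hSC'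
        linarith

/-- The landed cutoff toolkit supplies the abstract one (`ζ = cutoffField ε`). -/
theorem abstractCutoffToolkit_holds : AbstractCutoffToolkit := by
  obtain ⟨D, hD0, h⟩ := stub_cutoffFieldToolkit
  exact ⟨D, hD0, fun ε hε => ⟨cutoffField ε, h ε hε⟩⟩

/-- **STUB 1 of line SketchK1** (`stub_activityDomination : ActivityDomination`, registered on
stmt-AtomisticToContinuum-13734): the co-moving localized pair-virial domination of the window activity,
`a_i ≤ F¹_i + C (F²_i + Fcr_i)` pathwise on the good set. -/
theorem stub_activityDomination : ActivityDomination :=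
  activityDomination_of abstractCutoffToolkit_holds stub_pairVirialToolkit stub_collisionStepToolkit

end Summit.AtomisticToContinuum.HydrodynamicLimit.Theorems.CollisionActivityTailsActivityDomination

end
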